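import Summits.Ventures.PercRepro.Night2FatZDegen

/-!
# night-2: the degenerate two-planes regime — cross pairs off the class basis lines are unloaded

In the two-planes regime with the points `A` of `π₂` off the spine of rank `≥ 3` (the other plane may be
degenerate), a target above a lossy basis pair whose `Y` contains `y₂ ∈ A` and `y₃ ∈ π₃ ∖ L` is unloaded as
soon as `y₂` lies on no class basis line `ℓ_ab` (two basis points `a, b`, coplanar with the off-points) that is
coplanar with the points `M` of `π₃` off the spine: a distance-1 line would contain both (a cross line has two
points), a distance-2 line misses at most one of them, contains the other, cannot lie in `π₃` off the spine
(`rkN_off_le_two_of_line_of_source_planes` against `rk A ≥ 3`) and in `π₂` is the line `ℓ_ab` through its two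
basis points, coplanar with `M` (`source_planes_of_line_off_spine`).  Paper `proofs/NIGHT-2-g34.md` §6′ (d).
-/

namespace PercRepro.Shadow

open PercRepro.ThmH PercRepro.PerFlat

variable {α : Type*} [DecidableEq α] {M : Matroid α} [M.Finite] {G : Finset α}

/-- **Cross pairs off the class basis lines are unloaded in the degenerate regime.** -/
theorem dload_eq_zero_of_cross_pair_deg (hG : G ∈ flatsQ M (5 + 1)) (hd : (gr M \ G).card = 2)
    (hk : kColoops M G = 1) (hs : ∀ e ∈ gr M, ∀ f ∈ gr M, e ≠ f → rkN M {e, f} = 2)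
    (hl : ∀ e ∈ gr M, M.Indep {e}) (hfat : (fatClosures M 5 G 2).card ≤ 1) {B₀ : Finset α}
    (hB₀ : B₀ ∈ thinMembers M 5 G) {w₀ x : α} (hD : G \ clF M B₀ = {w₀, x}) {R₁ : Finset α}
    (hR₁V : R₁ ⊆ (G \ coloops M G) \ {w₀, x}) (hR₁2 : rkN M R₁ = 2) (hR₁3 : 3 ≤ R₁.card) {c₂ c₃ : α}
    (hc₂V : c₂ ∈ (G \ coloops M G) \ {w₀, x}) (hc₃V : c₃ ∈ (G \ coloops M G) \ {w₀, x})
    (hc₂ : c₂ ∉ clF M R₁) (hc₃ : c₃ ∉ clF M (insert c₂ R₁))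
    (hcover : ∀ e ∈ (G \ coloops M G) \ {w₀, x}, e ∈ clF M (insert c₂ R₁) ∨ e ∈ clF M (insert c₃ R₁))
    (hnd₂ : 3 ≤ rkN M (((G \ coloops M G) \ {w₀, x}).filter
      (fun e => e ∈ clF M (insert c₂ R₁) ∧ e ∉ clF M R₁)))
    {B : Finset α} (hB : B ∈ thinMembers M 5 G) (hnP : ¬ bigP M G B) {z : α} (hz : z ∈ G \ clF M B)
    (hxQ : x ∉ insert z B) {T : Finset α} (hT : T ∈ tgtSets M 5 G B z) (hxT : x ∈ T) {y₂ y₃ : α}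
    (hy₂ : y₂ ∈ (T \ insert z B).erase x) (hy₃ : y₃ ∈ (T \ insert z B).erase x)
    (hy₂2 : y₂ ∈ clF M (insert c₂ R₁)) (hy₂L : y₂ ∉ clF M R₁) (hy₃3 : y₃ ∈ clF M (insert c₃ R₁))
    (hy₃L : y₃ ∉ clF M R₁)
    (hρ : ∀ a ∈ insert z B, ∀ b ∈ insert z B, a ≠ b → y₂ ∈ clF M {a, b} →
      rkN M (insert w₀ (insert x {a, b})) ≤ 3 →
      4 ≤ rkN M ({a, b} ∪ ((G \ coloops M G) \ {w₀, x}).filter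
        (fun e => e ∈ clF M (insert c₃ R₁) ∧ e ∉ clF M R₁))) :
    dload M 5 G (bigP M G) (dshGT2 M 5 G) T = 0 := by
  by_contra hload
  have hGg : G ⊆ gr M := (mem_flatsQ.1 hG).1
  have hTG : T ⊆ G := subset_G_of_mem_shadowAt (mem_tgtSets.1 hT).1
  have hVg : (G \ coloops M G) \ {w₀, x} ⊆ gr M := fun e he =>
    hGg (Finset.mem_sdiff.1 (Finset.mem_sdiff.1 he).1).1
  have hR₁g : R₁ ⊆ gr M := hR₁V.trans hVg
  have hc₂g : c₂ ∈ gr M := hVg hc₂V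
  have hc₃g : c₃ ∈ gr M := hVg hc₃V
  obtain ⟨R, hR, hR2, hR3, hcase⟩ := loaded_fat_target_dichotomy' hG hd hk hs hl hfat hB₀ hD hTG hload
  have hRV : R ⊆ (G \ coloops M G) \ {w₀, x} := fun r hr =>
    Finset.sdiff_subset_sdiff (Finset.sdiff_subset_sdiff hTG (Finset.Subset.refl _)) (Finset.Subset.refl _) (hR hr)
  have hRg : R ⊆ gr M := hRV.trans hVg
  have hRcover : ∀ e ∈ R, e ∈ clF M (insert c₂ R₁) ∨ e ∈ clF M (insert c₃ R₁) := fun e he => hcover e (hRV he)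
  have hnot : ¬ (y₂ ∈ R ∧ y₃ ∈ R) := by
    rintro ⟨h2, h3⟩
    have := card_le_two_of_rkN_le_two_of_cross hs hR₁g hc₂g hc₃g hc₂ hc₃ hRg (by omega) hRcover h2 hy₂2 hy₂L
      h3 hy₃3 hy₃L
    omega
  have hS₂ : ∀ e ∈ ((G \ coloops M G) \ {w₀, x}).filter (fun e => e ∈ clF M (insert c₂ R₁) ∧ e ∉ clF M R₁),
      e ∈ clF M (insert c₂ R₁) ∧ e ∉ clF M R₁ := fun e he => (Finset.mem_filter.1 he).2
  rcases hcase with ⟨hRc, -⟩ | ⟨hRc, hRcls, c₂', hc₂'T, c₃', hc₃'T, hc₂', hc₃', hcover'⟩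
  · obtain ⟨hYR, -⟩ := sdiff_subset_line_of_dist_one_fat hG hd hk hB hnP hz hT hxT hxQ hR hR2 hRc
    exact hnot ⟨hYR hy₂, hYR hy₃⟩
  · obtain ⟨hY1, hRQ2⟩ := card_sdiff_line_le_one_of_dist_two hG hd hk hB hnP hz hT hxT hxQ hR hR2 hRc
    have hc₂'g : c₂' ∈ gr M := hGg (hTG (Finset.mem_sdiff.1 (Finset.mem_sdiff.1 hc₂'T).1).1)
    have hc₃'g : c₃' ∈ gr M := hGg (hTG (Finset.mem_sdiff.1 (Finset.mem_sdiff.1 hc₃'T).1).1)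
    have hR₁cover' : ∀ e ∈ R₁, e ∈ clF M (insert c₂' R) ∨ e ∈ clF M (insert c₃' R) :=
      fun e he => hcover' e (hR₁V he)
    by_cases h3 : y₃ ∈ R
    · have h2 : y₂ ∉ R := fun h2 => hnot ⟨h2, h3⟩
      have hRπ : R ⊆ clF M (insert c₃ R₁) := by
        rcases subset_plane_of_rkN_le_two_of_cover hs hRg (by omega) hR3 hRcover with h' | h'
        · exact absurd (mem_clF_of_mem_two_planes hR₁g hc₂g hc₃g hc₂ hc₃ (h' h3) hy₃3) hy₃L
        · exact h'
      have := rkN_off_le_two_of_line_of_source_planes hs hR₁g hR₁2 hR₁3 hc₂g hc₃g hc₂ hc₃ hRg hR2 hRπ h3 hy₃L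
        hc₂'g hc₃'g hc₂' hc₃' hS₂ (fun e he => hcover' e (Finset.mem_filter.1 he).1) hR₁cover'
      omega
    · have h2 : y₂ ∈ R := by
        by_contra h2
        have hsub : ({y₂, y₃} : Finset α) ⊆ ((T \ insert z B).erase x) \ R := by
          intro e he
          rw [Finset.mem_insert, Finset.mem_singleton] at he
          rcases he with rfl | rfl
          · exact Finset.mem_sdiff.2 ⟨hy₂, h2⟩
          · exact Finset.mem_sdiff.2 ⟨hy₃, h3⟩
        have hne : y₂ ≠ y₃ := by
          intro h'
          subst h'
          exact hy₂L (mem_clF_of_mem_two_planes hR₁g hc₂g hc₃g hc₂ hc₃ hy₂2 hy₃3)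
        have := Finset.card_le_card hsub
        rw [Finset.card_pair hne] at this
        omega
      -- `R ⊆ π₂`, off the spine at `y₂`: its source planes are `π₂` and a plane through `M`
      have hRπ : R ⊆ clF M (insert c₂ R₁) := by
        rcases subset_plane_of_rkN_le_two_of_cover hs hRg (by omega) hR3 hRcover with h' | h'
        · exact h'
        · exact absurd (mem_clF_of_mem_two_planes hR₁g hc₂g hc₃g hc₂ hc₃ hy₂2 (h' h2)) hy₂L
      set Mset := ((G \ coloops M G) \ {w₀, x}).filter
        (fun e => e ∈ clF M (insert c₃ R₁) ∧ e ∉ clF M R₁) with hMset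
      have hMS : ∀ e ∈ Mset, e ∉ clF M (insert c₂ R₁) := by
        intro e he h'
        have he' := (Finset.mem_filter.1 he).2
        exact he'.2 (mem_clF_of_mem_two_planes hR₁g hc₂g hc₃g hc₂ hc₃ h' he'.1)
      have hRM : rkN M (R ∪ Mset) ≤ 3 :=
        source_planes_of_line_off_spine hs hR₁g hR₁2 hR₁3 hc₂g hc₂ hRg hR2 hRπ h2 hy₂L hc₂'g hc₃'g hc₂' hc₃'
          hMS (fun e he => hcover' e (Finset.mem_filter.1 he).1) hR₁cover'
      -- `R` carries exactly two basis points `a ≠ b`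
      have hlev := card_sdiff_coloops_eq_level_add_five hG hd hk hB hnP hz hT
      have hxTQ : x ∈ T \ insert z B := Finset.mem_sdiff.2 ⟨hxT, hxQ⟩
      have hY : ((T \ insert z B).erase x).card + 1 = (T \ insert z B).card := by
        rw [Finset.card_erase_of_mem hxTQ]
        have : 0 < (T \ insert z B).card := Finset.card_pos.2 ⟨x, hxTQ⟩
        omega
      have hRsplit : R ⊆ (R ∩ insert z B) ∪ (((T \ insert z B).erase x) ∩ R) := by
        intro r hr
        rw [Finset.mem_union, Finset.mem_inter, Finset.mem_inter]
        by_cases hrQ : r ∈ insert z B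
        · exact Or.inl ⟨hr, hrQ⟩
        · refine Or.inr ⟨Finset.mem_erase.2 ⟨?_, Finset.mem_sdiff.2 ⟨(Finset.mem_sdiff.1 (hR hr)).1
            |> fun h => (Finset.mem_sdiff.1 h).1, hrQ⟩⟩, hr⟩
          intro h'
          exact (Finset.mem_sdiff.1 (hR hr)).2 (h' ▸ Finset.mem_insert_of_mem (Finset.mem_singleton_self _))
      have hYR : (((T \ insert z B).erase x) ∩ R).card + (((T \ insert z B).erase x) \ R).card =
          ((T \ insert z B).erase x).card := Finset.card_inter_add_card_sdiff _ _
      have hy₃' : y₃ ∈ ((T \ insert z B).erase x) \ R := Finset.mem_sdiff.2 ⟨hy₃, h3⟩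
      have hpos : 0 < (((T \ insert z B).erase x) \ R).card := Finset.card_pos.2 ⟨y₃, hy₃'⟩
      have hcard := Finset.card_le_card hRsplit
      have hcu := Finset.card_union_le (R ∩ insert z B) (((T \ insert z B).erase x) ∩ R)
      have h2le : 2 ≤ (R ∩ insert z B).card := by omega
      obtain ⟨a, ha, b, hb, hab⟩ := Finset.one_lt_card.1 (by omega : 1 < (R ∩ insert z B).card)
      have haR : a ∈ R := (Finset.mem_inter.1 ha).1
      have hbR : b ∈ R := (Finset.mem_inter.1 hb).1
      have habg : ({a, b} : Finset α) ⊆ gr M :=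
        Finset.insert_subset (hRg haR) (Finset.singleton_subset_iff.2 (hRg hbR))
      have hRab : R ⊆ clF M {a, b} :=
        subset_clF_of_rkN_le_two_of_two_mem hs hRg (by omega) haR hbR hab
          (subset_clF_of_subset_gr habg (Finset.mem_insert_self _ _))
          (subset_clF_of_subset_gr habg (Finset.mem_insert_of_mem (Finset.mem_singleton_self _)))
      have hcls : rkN M (insert w₀ (insert x {a, b})) ≤ 3 := by
        have : insert w₀ (insert x {a, b}) ⊆ insert w₀ (insert x R) :=
          Finset.insert_subset_insert _ (Finset.insert_subset_insert _
            (Finset.insert_subset haR (Finset.singleton_subset_iff.2 hbR)))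
        exact (rkN_mono this).trans hRcls
      have hcop : rkN M ({a, b} ∪ Mset) ≤ 3 := by
        have : ({a, b} : Finset α) ∪ Mset ⊆ R ∪ Mset :=
          Finset.union_subset_union (Finset.insert_subset haR (Finset.singleton_subset_iff.2 hbR))
            (Finset.Subset.refl _)
        exact (rkN_mono this).trans hRM
      have := hρ a (Finset.mem_inter.1 ha).2 b (Finset.mem_inter.1 hb).2 hab (hRab h2) hcls
      omega

end PercRepro.Shadow
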